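import Mathlib

/-!
# Crux `TwistedDetRank.TdrPerNotQP` (stmt-ValiantsHypothesis-6284), line `registered` —
# stub `stub_expBeatsQP`: an exponential beats every quasi-polynomial

Pure arithmetic used by the composition `conePowerRankNotQP_of` of the line: for every `c : ℕ`
there is an `m : ℕ` with

  `2 ^ ((Nat.log 2 m + c) ^ c) * 2 ^ m < 3 ^ m`.

We take `m = 2 ^ (k + 1)` with `k = (c + 1) * 2 * c`.  Then `Nat.log 2 m = k + 1`
(`Nat.log_pow`), and `k + 1 + c = (2c + 1)(c + 1) ≤ (2 · 2^c) · 2^c ≤ 2 ^ ((c + 1) * 2)`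
(from `c < 2 ^ c`), so `(k + 1 + c) ^ c ≤ 2 ^ k`; hence

  `2 ^ ((k + 1 + c) ^ c) * 2 ^ (2 · 2^k) ≤ 2 ^ (2^k) * 4 ^ (2^k) = 8 ^ (2^k) < 9 ^ (2^k)
    = 3 ^ (2 · 2^k)`.

No analysis and no project imports are needed.
-/

-- single-conjunct layout: Sub = Summit, duplicated namespace component intended
set_option linter.dupNamespace false

namespace Summit.ValiantsHypothesis.ValiantsHypothesis.Theorems.TwistedDetRankTdrPerNotQP

/-- The polynomial bound at the chosen exponent: with `k = (c + 1) * 2 * c` one has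
`(k + 1 + c) ^ c ≤ 2 ^ k` (since `k + 1 + c = (2c + 1)(c + 1) ≤ 4 ^ (c + 1)`). -/
theorem expBeatsQP_poly_le (c : ℕ) :
    ((c + 1) * 2 * c + 1 + c) ^ c ≤ 2 ^ ((c + 1) * 2 * c) := by
  rw [pow_mul]
  refine Nat.pow_le_pow_left ?_ c
  have h1 : c + 1 ≤ 2 ^ c := Nat.lt_two_pow_self
  have h2 : 2 * c + 1 ≤ 2 * 2 ^ c := by linarith
  calc (c + 1) * 2 * c + 1 + c = (2 * c + 1) * (c + 1) := by ring
    _ ≤ (2 * 2 ^ c) * 2 ^ c := Nat.mul_le_mul h2 h1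
    _ ≤ (2 * 2 ^ c) * (2 * 2 ^ c) := Nat.mul_le_mul_left _ (Nat.le_mul_of_pos_left _ two_pos)
    _ = 2 ^ ((c + 1) * 2) := by ring

/-- The comparison at `m = 2 ^ (k + 1)`: if `(k + 1 + c) ^ c ≤ 2 ^ k` then
`2 ^ ((log₂ m + c) ^ c) * 2 ^ m ≤ 8 ^ (2 ^ k) < 9 ^ (2 ^ k) = 3 ^ m`. -/
theorem expBeatsQP_at_two_pow (k c : ℕ) (h : (k + 1 + c) ^ c ≤ 2 ^ k) :
    2 ^ ((Nat.log 2 (2 ^ (k + 1)) + c) ^ c) * 2 ^ (2 ^ (k + 1)) < 3 ^ (2 ^ (k + 1)) := by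
  rw [Nat.log_pow one_lt_two, pow_succ']
  calc 2 ^ ((k + 1 + c) ^ c) * 2 ^ (2 * 2 ^ k)
      ≤ 2 ^ (2 ^ k) * 2 ^ (2 * 2 ^ k) :=
        Nat.mul_le_mul_right _ (Nat.pow_le_pow_right two_pos h)
    _ = 8 ^ (2 ^ k) := by rw [pow_mul, ← mul_pow]; norm_num
    _ < 9 ^ (2 ^ k) := Nat.pow_lt_pow_left (by norm_num) (by positivity)
    _ = 3 ^ (2 * 2 ^ k) := by rw [pow_mul]; norm_num

/-- **Stub `stub_expBeatsQP`** of crux `TwistedDetRank.TdrPerNotQP` (line `registered`):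
for every `c` some `m` has `2 ^ ((Nat.log 2 m + c) ^ c) * 2 ^ m < 3 ^ m` — the exponential
`(3/2)^m` beats every quasi-polynomial `2 ^ ((log₂ m + c) ^ c)`.  Witness:
`m = 2 ^ ((c + 1) * 2 * c + 1)`. -/
theorem stub_expBeatsQP :
    ∀ c : ℕ, ∃ m : ℕ, 2 ^ ((Nat.log 2 m + c) ^ c) * 2 ^ m < 3 ^ m :=
  fun c => ⟨2 ^ ((c + 1) * 2 * c + 1), expBeatsQP_at_two_pow _ c (expBeatsQP_poly_le c)⟩

end Summit.ValiantsHypothesis.ValiantsHypothesis.Theorems.TwistedDetRankTdrPerNotQP
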